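import Literature.MathematicalPhysics.QuantumFieldTheory.Balaban1983to89.Node00.TorusCoverLandau153RecTower
import Literature.MathematicalPhysics.QuantumFieldTheory.Balaban1983to89.Node00.TorusCoverLandau153TowerMember

/-!
# NODE 00 — THE R7 DOOR, STAGE 2 (push-down to the torus): [Balaban1985Variational] (152)+(153) ON THE DENTED RECORD TOWER, THROUGH THE TOP-ANCHORED COVER LIFT
# `x ↦ π(x + t)`, WITH THE MEMBER GAUGE EXPORTED — this lineage's g7 `exists_localGauge152_tower_window_of_gaugedBoundB8` + g8 `exists_localGauge152_tower_member` re-run from STAGE 1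
# (`exists_suGauge_letters152_recTower_member`) for a record datum `Node00.CubeB8DZ` and the translated lift `V x μ = ιSU (U ⟨π (x + t), μ⟩)` of FILE 39 (`Node00.TorusCoverBlockAveragingZd`)

Cell `pub-ymgap`, width seat `pub-ymgap-dag-n07-w3` g10 (N05-REC R7 pen; LEAD PEN dag-n05-e).  NEW leaf, THEOREMS ONLY.  CONSUMED BY NAME, nothing modified: STAGE 1 (`Node00.TorusCoverLandau153RecTower`),
this lineage's g0–g8 torus helpers (`cover_add_e ∕ cover_sub_e`, `cfgExp_eq_expI`, `pdiv_plaqCovDeriv_one_eq_sum`, `plaqCovDeriv_one_apply`, `covLap_one_apply`, the push-down pattern of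
`Node00.TorusCoverLandau153TowerWindow ∕ TowerMember`), r15's `cover`, pub-balaban's `Sect2.regionOfSet ∕ bondsDeep ∕ codiffCurlA ∕ curlA`, `B12RegularSpaces111.gaugeU ∕ expI ∕ grad`.
`--kind proof --supports stmt-QuantumFields-20541` (K0⁷; count-neutral).  [6] = [Balaban1985RegularSpaces]; [15] = [Balaban1985Variational]; [I] = [Balaban1987RG1].

THE LIFT.  The record's finest-level objects sit in «transcription coordinates»: the fine site `x ∈ ℤᵈ` is read on the torus at `π(x + t)`, `t = ctrShift L k·𝟙` (FILE 39's TOP-ANCHORED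
convention; LOCATED-L1: the record's CENTRED cubes `boxZ ∕ cubeZ ∕ tcubeZ` are the engine's corner cubes translated by `−t`, `B8Eq131CubesRecDictionary`).  This file keeps `t` FREE: every
statement holds for any translation `t`, the door's consumer fixes it.  The torus sets are `(fun x => π (x + t)) '' X`; with `t = ctrShift L k·𝟙` and `X = boxZ …` this is `π '' box …`
(`image_add_ctrShift_boxZ`), i.e. exactly the sets of N07's `HThm4Rec` rows.

WHAT IS PROVED (kernel; `P : Params`, `N ≥ 1`; no definition).
* §0 `cover_shift_add_e ∕ cover_shift_sub_e` (`π(x ± e_μ + t) = π(x + t) ± e_μ`), the window readings `codiffCurlA_coverShift_eq_pdiv_of_window`, `lap_coverShift_eq_covLap_of_window`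
  (g2's ∕ dag-n07-e's cover readings of the second-order letters, for the translated lift).
* §1 ★★★ `exists_localGauge152_recTower_window_member`: for a record datum `c : CubeB8DZ` of scale `c.k = n`, a torus field `U`, a translation `t`, the `SU(N)`-valued ∃-body of the RECORD
  crown `GaugedBoundB8DZ L η_n V c r` at the translated lift `V`, windows `X_t ⊆ X ⊆ X′` of `ℤᵈ` with `X ⊆ Ω′₀ ⊆ X′`, `X_t ⊆ □_k` (the PURE top cube, dent included), `x ↦ π(x + t)` injective
  on `X′` and the three step-closure rows, and the per-bond window `4·(N r) < 2π`: ONE torus gauge `u : GaugeTransf P 0 (SU N)`, ONE potential `A` and ONE member witness `u_m` with —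
  (1) the gauge equation `(ιU)^{ιu}(b) = expI η_n (A b)` on the bonds of `regionOfSet (π(X + t))`; (2) the level-weighted letters `‖A ⟨π(x+t), μ⟩‖ ≤ 2·(r·(Lʲη_n)⁻¹)` for `x, x + e_μ ∈ X ∩
  Ω′_j`, `j ≤ k`; (3)–(6) the four top letters on `π(X_t + t)` AT THE DENT's LEVEL `k − 1`: `‖A‖ ≤ 2rL`, `‖∇A‖ ≤ 2rL²`, `‖∂*∂A‖, ‖ΔA‖ ≤ 2rL³` (STAGE 1's `(L^{k−1}η_n)^{−α} = L^α`);
  (7) `A ⟨π(x+t), μ⟩ = logCfg η_n (U″^{u_m⁻¹}) x μ` on `X′` and the RECORD's (153) `IsLandau138Z L k η_n Ω′₀ Λ′ 1 (logCfg η_n (U″^{u_m⁻¹}))`; (8) ★ `ιSU (u (π(x+t))) = (u_m x)⁻¹·v_fix x`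
  on `Ω′₀`; (9) `u_m ∈ SU(N)`, `u_m = 1` off `Ω′₀`, ★ the RECORD's (1.29) `Restr129Z L k Λ′ 1 u_m`, the RECORD's (1.137) — the rows this lineage's g9 bridges (FILES 40–44) turn into
  N07's `NrmOfRecordWide` ∕ dag-n07-e's `NrmSymOfRecord` and the torus (153).
HONEST FRAMING: count-neutral push-down bookkeeping over a HYPOTHESIS — the record crown body, which the R6 re-key of the «N05-REC» road is to conclude; the windows' step-closure and the
non-wrapping of `x ↦ π(x + t)` on `X′` are DISPLAYED; nothing of [15] ∕ [6] ∕ [I] analysis asserted; `HThm4Rec` UNDISCHARGED (caveat (C-S3-1)); N07 ∕ N05 NOT discharged; counts unmoved;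
one finite 𝕋⁴ programme at fixed ε — R4 closes the conditional finite-𝕋⁴ rung `BalabanLadder.UV` only; the YM mass gap (Clay) is NOT proved by any of this; nothing continuum ∕ ℝ⁴ ∕ OS.
No `sorry`, no `def`, no `instance`, no `notation`.

References: [15] (144)–(153) pp.300–301; [6] Prop. 6 (1.135)–(1.138) p.99, (1.29) p.81, (1.131) p.99, p.98; [3] = [Balaban1985Averaging] (78)–(81) p.30; [I] (0.1) p.251, (0.3)–(0.4) pp.252–253.
-/

noncomputable section

namespace Literature.MathematicalPhysics.QuantumFieldTheory.Balaban1983to89.Node00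

open scoped Matrix.Norms.L2Operator
open Complex (I)
open B7Prop1Explicit (e e_apply gaugeAct)
open B7Prop1Local (InBox AgreeOn)
open B7Prop2Explicit (unitaryUnits mem_unitaryUnits)
open B7Prop2SpecialUnitary (specialUnitaryUnits mem_specialUnitaryUnits)
open BlockAveragingZd (avgIterZ ctrShift)
open B8Ineq132 (covDerivFwd covDeriv BondTouches)
open B8Eq131Cubes (tLo tHi ctr gs)
open B8Eq131CubesRec (boxZ cubeZ tcubeZ bLoZ bHiZ)
open B8Eq140Level (SideTouches)
open B8Eq138LandauZd (logCfg covDivB covLap)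
open B8Eq138LandauZdRec (IsLandau138Z IsLandau138WZ)
open B8Eq119TwistedAxialRec (Restr129Z)
open B7SectEFLinearisationRec (logCovIterZ)
open B8Eq184Proof (cfgExp)
open B8LeafModelZd3 (mlogCfg)
open B8ScaledSupNorm (msup Bdd bondNorm)
open B8Eq146AExpansion (plaqCovDeriv iEta)
open B8Eq143PlaqExpansion (pdiv)
open MatrixLog (mlog)
open B15Eq112TorusCover (cover)
open B14DomainGeom (Pt)
open B12RegularSpaces111 (gaugeU expI grad)

variable {P : Params} {N : ℕ} [NeZero N]

/-! ## §0  The translated cover `x ↦ π(x + t)`: unit steps and the second-order letters -/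

section ShiftedCover

omit [NeZero N] in
/-- `π(x + e_μ + t) = π(x + t) + e_μ` (the translated cover intertwines forward unit steps). [cite: Balaban1987RG1, (0.1) p.251 (the torus)] -/
theorem cover_shift_add_e (x t : Pt P.d) (μ : Fin P.d) : cover P (x + e μ + t) = (cover P (x + t)).shift μ := by
  rw [add_right_comm, cover_add_e]

omit [NeZero N] in
/-- `π(x − e_μ + t) = π(x + t) − e_μ`. [cite: Balaban1987RG1, (0.1) p.251 (the torus)] -/
theorem cover_shift_sub_e (x t : Pt P.d) (μ : Fin P.d) : cover P (x - e μ + t) = (cover P (x + t)).unshift μ := by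
  rw [sub_add_eq_add_sub, cover_sub_e]

omit [NeZero N] in
/-- dag-n07-e's `codiffCurlA_cover_eq_pdiv_of_window` for the TRANSLATED lift: if `A ⟨π(z + t), κ⟩ = A′ z κ` on a window `X` containing the second-order stencil of the bond `⟨x, x+e_μ⟩`,
the torus letter `Sect2.codiffCurlA η A (π(x + t)) μ` IS `pdiv η 1 (plaqCovDeriv η 1 A′) μ x`. [cite: Balaban1985RegularSpaces, (1.1)–(1.2) p.76; Balaban1987RG1, (0.1) p.251] -/
theorem codiffCurlA_coverShift_eq_pdiv_of_window (η : ℝ) (t : Pt P.d) {X : Set (Pt P.d)} {A : PBond P 0 → MatA N} {A' : B7Prop1Explicit.Site P.d → Fin P.d → MatA N}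
    (hA : ∀ z, z ∈ X → ∀ κ, A ⟨cover P (z + t), κ⟩ = A' z κ) {x : B7Prop1Explicit.Site P.d} {μ : Fin P.d}
    (hx : x ∈ X) (hxμ : x + e μ ∈ X) (hν : ∀ ν, x + e ν ∈ X ∧ x - e ν ∈ X ∧ x - e ν + e μ ∈ X) :
    Sect2.codiffCurlA η A (cover P (x + t)) μ = pdiv η (1 : B7Prop1Explicit.Site P.d → Fin P.d → (MatA N)ˣ) (plaqCovDeriv η 1 A') μ x := by
  rw [pdiv_plaqCovDeriv_one_eq_sum, Sect2.codiffCurlA]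
  refine Finset.sum_congr rfl fun ν _ => ?_
  obtain ⟨h1, h2, h3⟩ := hν ν
  rw [← cover_shift_sub_e, Sect2.curlA, Sect2.curlA, grad, grad, grad, grad, ← cover_shift_add_e, ← cover_shift_add_e, ← cover_shift_add_e, ← cover_shift_add_e,
    plaqCovDeriv_one_apply, plaqCovDeriv_one_apply]
  simp only [sub_add_cancel, hA _ hx, hA _ hxμ, hA _ h1, hA _ h2, hA _ h3, ← Complex.ofReal_inv, Complex.coe_smul]

omit [NeZero N] in
/-- g2's `lap_cover_eq_covLap_of_window` for the TRANSLATED lift: the Laplacian member in `grad` letters at `π(x + t)` IS `covLap η 1 (A′ · μ) x`.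
[cite: Balaban1985BackgroundPropagators, (3.23) p.394; Balaban1985RegularSpaces, (1.136) p.99; Balaban1987RG1, (0.1) p.251] -/
theorem lap_coverShift_eq_covLap_of_window (η : ℝ) (t : Pt P.d) {X : Set (Pt P.d)} {A : PBond P 0 → MatA N} {A' : B7Prop1Explicit.Site P.d → Fin P.d → MatA N}
    (hA : ∀ z, z ∈ X → ∀ κ, A ⟨cover P (z + t), κ⟩ = A' z κ) {x : B7Prop1Explicit.Site P.d}
    (hx : x ∈ X) (hν : ∀ ν, x + e ν ∈ X ∧ x - e ν ∈ X) (μ : Fin P.d) :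
    ∑ ν : Fin P.d, ((η : ℝ) : ℂ)⁻¹ • (grad η ν (fun y => A ⟨y, μ⟩) ((cover P (x + t)).unshift ν) - grad η ν (fun y => A ⟨y, μ⟩) (cover P (x + t))) =
      covLap η (1 : B7Prop1Explicit.Site P.d → Fin P.d → (MatA N)ˣ) (fun z => A' z μ) x := by
  rw [covLap_one_apply]
  refine Finset.sum_congr rfl fun ν _ => ?_
  obtain ⟨h1, h2⟩ := hν ν
  rw [← cover_shift_sub_e, grad, grad, ← cover_shift_add_e, ← cover_shift_add_e, sub_add_cancel]
  simp only [hA _ hx, hA _ h1, hA _ h2, ← Complex.ofReal_inv, Complex.coe_smul]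

end ShiftedCover

/-! ## §1  The door: STAGE 1 pushed down through `x ↦ π(x + t)`, member rows exported -/

section Door

/-- ★★★ **THE (152)+(153) DOOR ON THE DENTED RECORD TOWER, THROUGH THE TRANSLATED COVER LIFT, MEMBER ROWS EXPORTED** (statement in the module docstring): STAGE 1
(`exists_suGauge_letters152_recTower_member`) pushed down exactly as this lineage's g7∕g8 tower doors, with `π` replaced by `x ↦ π(x + t)`; the four top letters come at the dent's
level `k − 1` (`2rL`, `2rL²`, `2rL³`, `2rL³`). [cite: Balaban1985Variational, (144)–(153) pp.300–301; Balaban1985RegularSpaces, Prop. 6 (1.135)–(1.138) p.99, (1.29) p.81, (1.131) p.99, p.98; Balaban1985Averaging, (78)–(81) p.30; Balaban1987RG1, (0.1) p.251, (0.3)–(0.4) pp.252–253] -/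
theorem exists_localGauge152_recTower_window_member (hd : 2 ≤ P.d) {K' : ℕ} {Ω' : ℕ → Set (B7Prop1Explicit.Site P.d)} (c : CubeB8DZ P.d P.L K' Ω')
    (U : GaugeField P 0 (SU N)) (t : Pt P.d) {n : ℕ} (hk : c.k = n) {r : ℝ} (hr : 0 ≤ r)
    (hG : letI : CStarAlgebra (MatA N) := {};
      ∃ u : B7Prop1Explicit.Site P.d → (MatA N)ˣ, (∀ x, u x ∈ specialUnitaryUnits (Fin N)) ∧ (∀ x, x ∉ c.sq 0 → u x = 1) ∧
        Restr129Z P.L c.k c.lamS (1 : B7Prop1Explicit.Site P.d → Fin P.d → (MatA N)ˣ) u ∧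
        IsLandau138WZ P.L c.k (P.eta n) (c.sq 0) c.lamS (1 : B7Prop1Explicit.Site P.d → Fin P.d → (MatA N)ˣ)
          (c.fixed (fun x μ => ιSU N (U ⟨cover P (x + t), μ⟩)) u) ∧
        (∀ j, j ≤ c.k → ∀ b ∈ {b : B7Prop1Explicit.Site P.d × Fin P.d | SideTouches (c.sq j) b.1 b.2},
          c.fixed (fun x μ => ιSU N (U ⟨cover P (x + t), μ⟩)) u b.1 b.2 =
              cfgExp (P.eta n) (logCfg (P.eta n) (c.fixed (fun x μ => ιSU N (U ⟨cover P (x + t), μ⟩)) u)) b.1 b.2 ∧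
            IsSelfAdjoint (logCfg (P.eta n) (c.fixed (fun x μ => ιSU N (U ⟨cover P (x + t), μ⟩)) u) b.1 b.2) ∧
            ‖logCfg (P.eta n) (c.fixed (fun x μ => ιSU N (U ⟨cover P (x + t), μ⟩)) u) b.1 b.2‖ ≤ r * ((P.L : ℝ) ^ j * P.eta n)⁻¹) ∧
        (∀ x, ((c.vfix (fun x μ => ιSU N (U ⟨cover P (x + t), μ⟩)))⁻¹ * u) x ∈ specialUnitaryUnits (Fin N)) ∧
        AgreeOn (B8Ineq130Rec.tlo P.L (tLo c.a c.ρ) c.k) (B8Ineq130Rec.thi P.L (tHi c.a c.M c.ρ) c.k)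
          (gaugeAct ((c.vfix (fun x μ => ιSU N (U ⟨cover P (x + t), μ⟩)))⁻¹ * u)⁻¹ (fun x μ => ιSU N (U ⟨cover P (x + t), μ⟩)))
          (c.fixed (fun x μ => ιSU N (U ⟨cover P (x + t), μ⟩)) u) ∧
        msup P.L c.k (P.eta n) (-(2 : ℝ)) (fun j (q : Fin P.d × Fin P.d × B7Prop1Explicit.Site P.d) => SideTouches (c.sq j) q.2.2 q.2.1)
            (fun q => covDerivFwd (P.eta n) (1 : B7Prop1Explicit.Site P.d → Fin P.d → (MatA N)ˣ) q.1
              (fun z => c.expo (P.eta n) (fun x μ => ιSU N (U ⟨cover P (x + t), μ⟩)) u z q.2.1) q.2.2) ≤ r ∧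
        bondNorm P.L c.k (P.eta n) (-(3 : ℝ)) c.sq
            (fun x μ => pdiv (P.eta n) (1 : B7Prop1Explicit.Site P.d → Fin P.d → (MatA N)ˣ)
              (plaqCovDeriv (P.eta n) (1 : B7Prop1Explicit.Site P.d → Fin P.d → (MatA N)ˣ)
                (c.expo (P.eta n) (fun x μ => ιSU N (U ⟨cover P (x + t), μ⟩)) u)) μ x) ≤ r ∧
        bondNorm P.L c.k (P.eta n) (-(3 : ℝ)) c.sq
            (fun x μ => covLap (P.eta n) (1 : B7Prop1Explicit.Site P.d → Fin P.d → (MatA N)ˣ)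
              (fun z => c.expo (P.eta n) (fun x μ => ιSU N (U ⟨cover P (x + t), μ⟩)) u z μ) x) ≤ r ∧
        (∀ (x : B7Prop1Explicit.Site P.d) (μ : Fin P.d), bLoZ P.L c.a 0 0 ≤ x → x + e μ ≤ bHiZ P.L c.a c.M 0 0 → c.inTop x → c.inTop (x + e μ) →
          logCovIterZ P.L (1 : B7Prop1Explicit.Site P.d → Fin P.d → (MatA N)ˣ)
              (iEta (P.eta n) (c.expo (P.eta n) (fun x μ => ιSU N (U ⟨cover P (x + t), μ⟩)) u)) c.k x μ =
            mlog ((avgIterZ P.L (c.axial (fun x μ => ιSU N (U ⟨cover P (x + t), μ⟩))) c.k x μ : (MatA N)ˣ) : MatA N)))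
    {X Xt X' : Set (Pt P.d)} (hXX' : X ⊆ X') (hXt : Xt ⊆ X) (hsq0X' : c.sq 0 ⊆ X') (hinj' : Set.InjOn (fun x => cover P (x + t)) X')
    (hfwd : ∀ ⦃x⦄, x ∈ X → ∀ μ, (cover P (x + t)).shift μ ∈ (fun x => cover P (x + t)) '' X → x + e μ ∈ X)
    (hfwdt : ∀ ⦃x⦄, x ∈ Xt → ∀ μ, (cover P (x + t)).shift μ ∈ (fun x => cover P (x + t)) '' Xt → x + e μ ∈ Xt)
    (hbwdt : ∀ ⦃x⦄, x ∈ Xt → ∀ ν, (cover P (x + t)).unshift ν ∈ (fun x => cover P (x + t)) '' Xt → x - e ν ∈ Xt)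
    (hsq : X ⊆ c.sq 0) (hbox : Xt ⊆ cubeZ P.L c.a c.M c.ρ c.k c.k)
    (h4 : 4 * ((N : ℝ) * r) < 2 * Real.pi) :
    letI : CStarAlgebra (MatA N) := {}
    ∃ u : GaugeTransf P 0 (SU N), ∃ A : PBond P 0 → MatA N, ∃ um : B7Prop1Explicit.Site P.d → (MatA N)ˣ,
      (∀ b ∈ (Sect2.regionOfSet P ((fun x => cover P (x + t)) '' X)).bonds, gaugeU (fun x => ιSU N (u x)) (fun b' => ιSU N (U b')) b = expI (P.eta n) (A b)) ∧
      (∀ j, j ≤ c.k → ∀ (x : Pt P.d) (μ : Fin P.d), x ∈ X → x + e μ ∈ X → x ∈ c.sq j → x + e μ ∈ c.sq j →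
          ‖A ⟨cover P (x + t), μ⟩‖ ≤ 2 * (r * ((P.L : ℝ) ^ j * P.eta n)⁻¹)) ∧
      (∀ b ∈ (Sect2.regionOfSet P ((fun x => cover P (x + t)) '' Xt)).bonds, ‖A b‖ ≤ 2 * (r * P.L)) ∧
      (∀ q ∈ (Sect2.regionOfSet P ((fun x => cover P (x + t)) '' Xt)).dpairs, ‖grad (P.eta n) q.2.1 (fun y => A ⟨y, q.2.2⟩) q.1‖ ≤ 2 * (r * (P.L : ℝ) ^ 2)) ∧
      (∀ b ∈ Sect2.bondsDeep ((fun x => cover P (x + t)) '' Xt), ‖Sect2.codiffCurlA (P.eta n) A b.src b.dir‖ ≤ 2 * (r * (P.L : ℝ) ^ 3)) ∧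
      (∀ b ∈ Sect2.bondsDeep ((fun x => cover P (x + t)) '' Xt),
          ‖∑ ν : Fin P.d, ((P.eta n : ℝ) : ℂ)⁻¹ •
              (grad (P.eta n) ν (fun y => A ⟨y, b.dir⟩) (b.src.unshift ν) - grad (P.eta n) ν (fun y => A ⟨y, b.dir⟩) b.src)‖ ≤ 2 * (r * (P.L : ℝ) ^ 3)) ∧
      (∀ x, x ∈ X' → ∀ μ, A ⟨cover P (x + t), μ⟩ = logCfg (P.eta n) (c.fixed (fun x μ => ιSU N (U ⟨cover P (x + t), μ⟩)) um) x μ) ∧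
      IsLandau138Z P.L c.k (P.eta n) (c.sq 0) c.lamS (1 : B7Prop1Explicit.Site P.d → Fin P.d → (MatA N)ˣ)
        (logCfg (P.eta n) (c.fixed (fun x μ => ιSU N (U ⟨cover P (x + t), μ⟩)) um)) ∧
      (∀ x, x ∈ c.sq 0 → ιSU N (u (cover P (x + t))) = (um x)⁻¹ * c.vfix (fun x μ => ιSU N (U ⟨cover P (x + t), μ⟩)) x) ∧
      (∀ x, um x ∈ specialUnitaryUnits (Fin N)) ∧ (∀ x, x ∉ c.sq 0 → um x = 1) ∧
      Restr129Z P.L c.k c.lamS (1 : B7Prop1Explicit.Site P.d → Fin P.d → (MatA N)ˣ) um ∧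
      (∀ (x : B7Prop1Explicit.Site P.d) (μ : Fin P.d), bLoZ P.L c.a 0 0 ≤ x → x + e μ ≤ bHiZ P.L c.a c.M 0 0 → c.inTop x → c.inTop (x + e μ) →
        logCovIterZ P.L (1 : B7Prop1Explicit.Site P.d → Fin P.d → (MatA N)ˣ)
            (iEta (P.eta n) (c.expo (P.eta n) (fun x μ => ιSU N (U ⟨cover P (x + t), μ⟩)) um)) c.k x μ =
          mlog ((avgIterZ P.L (c.axial (fun x μ => ιSU N (U ⟨cover P (x + t), μ⟩))) c.k x μ : (MatA N)ˣ) : MatA N)) := by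
  classical
  letI : CStarAlgebra (MatA N) := {}
  have hLo : Odd P.L := P.hL.1
  have hL : 2 ≤ P.L := P.hL.2
  have hηpos : 0 < P.eta n := B3GkZeroTorusRescaled.eta_pos P n
  set V : B7Prop1Explicit.Site P.d → Fin P.d → (MatA N)ˣ := fun x μ => ιSU N (U ⟨cover P (x + t), μ⟩) with hV
  have hVsu : ∀ x μ, V x μ ∈ specialUnitaryUnits (Fin N) := fun x μ => by
    rw [hV]; exact mem_specialUnitaryUnits.2 (U ⟨cover P (x + t), μ⟩).2
  obtain ⟨s, um, h1, hlev, h2, h3, h4c, h4', h5, hsid, hsu, hoff, h129, h137⟩ :=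
    exists_suGauge_letters152_recTower_member hd hLo hL c V hVsu hηpos hr hG h4
  -- the scale of the dent's level: `L^{k−1}·η_n = L⁻¹`, `Lᵏ·η_n = 1`
  have hscale : (P.L : ℝ) ^ c.k * P.eta n = 1 := by rw [hk]; exact B12Eq115BackgroundPair.pow_mul_eta P n
  have hLpos : (0 : ℝ) < P.L := by exact_mod_cast P.L_pos
  have hscale' : (P.L : ℝ) ^ (c.k - 1) * P.eta n = (P.L : ℝ)⁻¹ := by
    have hk1 : c.k - 1 + 1 = c.k := Nat.sub_add_cancel c.one_le_k
    have h : (P.L : ℝ) ^ c.k = (P.L : ℝ) ^ (c.k - 1) * P.L := by rw [← pow_succ, hk1]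
    have h' : (P.L : ℝ) ^ (c.k - 1) * P.eta n * P.L = 1 := by rw [mul_right_comm, ← h, hscale]
    exact eq_inv_of_mul_eq_one_left h'
  simp only [hscale', inv_inv, inv_pow] at h2 h3 h4c h4'
  set A' : B7Prop1Explicit.Site P.d → Fin P.d → MatA N := logCfg (P.eta n) (c.fixed V um) with hA'
  have hinjt : Set.InjOn (fun x => cover P (x + t)) Xt := hinj'.mono (hXt.trans hXX')
  -- push-down through the translated cover, injective on the LARGE window `X′`
  let u : GaugeTransf P 0 (SU N) := fun y =>
    if h : ∃ x, x ∈ X' ∧ cover P (x + t) = y then s (Classical.choose h) else 1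
  let A : PBond P 0 → MatA N := fun b =>
    if h : ∃ x, x ∈ X' ∧ cover P (x + t) = b.src then A' (Classical.choose h) b.dir else 0
  have hu : ∀ x, x ∈ X' → u (cover P (x + t)) = s x := by
    intro x hx
    have hex : ∃ x', x' ∈ X' ∧ cover P (x' + t) = cover P (x + t) := ⟨x, hx, rfl⟩
    simp only [u, dif_pos hex]
    rw [hinj' (Classical.choose_spec hex).1 hx (Classical.choose_spec hex).2]
  have hA : ∀ x, x ∈ X' → ∀ μ, A ⟨cover P (x + t), μ⟩ = A' x μ := by
    intro x hx μ
    have hex : ∃ x', x' ∈ X' ∧ cover P (x' + t) = cover P (x + t) := ⟨x, hx, rfl⟩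
    simp only [A, dif_pos hex]
    rw [hinj' (Classical.choose_spec hex).1 hx (Classical.choose_spec hex).2]
  have hlift : ∀ y, y ∈ (fun x => cover P (x + t)) '' X → ∃ x, x ∈ X ∧ cover P (x + t) = y := fun y ⟨x, hx, hxy⟩ => ⟨x, hx, hxy⟩
  have hliftt : ∀ y, y ∈ (fun x => cover P (x + t)) '' Xt → ∃ x, x ∈ Xt ∧ cover P (x + t) = y := fun y ⟨x, hx, hxy⟩ => ⟨x, hx, hxy⟩
  have hXtX' : Xt ⊆ X' := hXt.trans hXX'
  have hL1 : (1 : ℝ) ≤ P.L := by exact_mod_cast P.L_pos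
  refine ⟨u, A, um, fun b hb => ?_, fun j hj x μ hx hx' hxj hxj' => ?_, fun b hb => ?_, fun q hq => ?_, fun b hb => ?_, fun b hb => ?_, hA, h5,
    fun x hx => ?_, hsu, hoff, h129, h137⟩
  · obtain ⟨x, hx, hxs⟩ := hlift b.src hb.1
    have hx' : x + e b.dir ∈ X := hfwd hx b.dir (by rw [hxs]; exact hb.2)
    have hb' : b = ⟨cover P (x + t), b.dir⟩ := by cases b; simp only at hxs; rw [hxs]
    rw [hb', hA x (hXX' hx)]
    have hgauge := h1 x b.dir (hsq hx) (hsq hx')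
    rw [cfgExp_eq_expI] at hgauge
    rw [← hgauge]
    simp only [gaugeU, B7Prop1Explicit.gaugeAct, PBond.tgt, ← cover_shift_add_e, hu x (hXX' hx), hu (x + e b.dir) (hXX' hx'), hV]
  · rw [hA x (hXX' hx)]
    exact hlev j hj x μ hxj hxj'
  · obtain ⟨x, hx, hxs⟩ := hliftt b.src hb.1
    have hx' : x + e b.dir ∈ Xt := hfwdt hx b.dir (by rw [hxs]; exact hb.2)
    have hb' : b = ⟨cover P (x + t), b.dir⟩ := by cases b; simp only at hxs; rw [hxs]
    rw [hb', hA x (hXtX' hx)]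
    exact h2 x b.dir (hbox hx) (hbox hx')
  · obtain ⟨hq1, hq2, hq3, -⟩ := hq
    obtain ⟨x, hx, hxs⟩ := hliftt q.1 hq1
    have hxμ : x + e q.2.1 ∈ Xt := hfwdt hx q.2.1 (by rw [hxs]; exact hq2)
    have hxν : x + e q.2.2 ∈ Xt := hfwdt hx q.2.2 (by rw [hxs]; exact hq3)
    rw [grad, ← hxs, ← cover_shift_add_e, hA x (hXtX' hx), hA (x + e q.2.1) (hXtX' hxμ), norm_smul, norm_inv, Complex.norm_real, Real.norm_eq_abs,
      abs_of_pos hηpos]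
    calc (P.eta n)⁻¹ * ‖A' (x + e q.2.1) q.2.2 - A' x q.2.2‖ ≤ (P.eta n)⁻¹ * (2 * (P.eta n * r * (P.L : ℝ) ^ 2)) :=
          mul_le_mul_of_nonneg_left (h3 x q.2.1 q.2.2 (hbox hx) (hbox hxμ) (hbox hxν)) (inv_nonneg.2 hηpos.le)
      _ = 2 * (r * (P.L : ℝ) ^ 2) := by field_simp
  · obtain ⟨hb1, hb2, hbν⟩ := hb
    obtain ⟨x, hx, hxs⟩ := hliftt b.src hb1
    have hxμ : x + e b.dir ∈ Xt := hfwdt hx b.dir (by rw [hxs]; exact hb2)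
    have hstencil : ∀ ν, x + e ν ∈ Xt ∧ x - e ν ∈ Xt ∧ x - e ν + e b.dir ∈ Xt := by
      intro ν
      obtain ⟨s1, s2, s3, s4⟩ := hbν ν
      have hxν : x + e ν ∈ Xt := hfwdt hx ν (by rw [hxs]; exact s1)
      have hxν' : x - e ν ∈ Xt := hbwdt hx ν (by rw [hxs]; exact s2)
      have hxν'' : x - e ν + e b.dir ∈ Xt :=
        hfwdt hxν' b.dir (by
          rw [cover_shift_sub_e, hxs, ← Site.unshift_shift_comm]
          exact s4)
      exact ⟨hxν, hxν', hxν''⟩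
    have hb' : b = ⟨cover P (x + t), b.dir⟩ := by cases b; simp only at hxs; rw [hxs]
    rw [hb']
    show ‖Sect2.codiffCurlA (P.eta n) A (cover P (x + t)) b.dir‖ ≤ 2 * (r * (P.L : ℝ) ^ 3)
    have hAX : ∀ z, z ∈ Xt → ∀ κ, A ⟨cover P (z + t), κ⟩ = A' z κ := fun z hz => hA z (hXtX' hz)
    rw [codiffCurlA_coverShift_eq_pdiv_of_window (P.eta n) t hAX hx hxμ hstencil]
    exact h4c x b.dir (hbox hx) (hbox hxμ) fun ν => ⟨hbox (hstencil ν).1, hbox (hstencil ν).2.1, hbox (hstencil ν).2.2⟩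
  · obtain ⟨hb1, hb2, hbν⟩ := hb
    obtain ⟨x, hx, hxs⟩ := hliftt b.src hb1
    have hxμ : x + e b.dir ∈ Xt := hfwdt hx b.dir (by rw [hxs]; exact hb2)
    have hstencil : ∀ ν, x + e ν ∈ Xt ∧ x - e ν ∈ Xt := by
      intro ν
      obtain ⟨s1, s2, -, -⟩ := hbν ν
      exact ⟨hfwdt hx ν (by rw [hxs]; exact s1), hbwdt hx ν (by rw [hxs]; exact s2)⟩
    have hb' : b = ⟨cover P (x + t), b.dir⟩ := by cases b; simp only at hxs; rw [hxs]
    rw [hb']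
    show ‖∑ ν : Fin P.d, ((P.eta n : ℝ) : ℂ)⁻¹ •
        (grad (P.eta n) ν (fun y => A ⟨y, b.dir⟩) ((cover P (x + t)).unshift ν) - grad (P.eta n) ν (fun y => A ⟨y, b.dir⟩) (cover P (x + t)))‖ ≤
          2 * (r * (P.L : ℝ) ^ 3)
    have hAX : ∀ z, z ∈ Xt → ∀ κ, A ⟨cover P (z + t), κ⟩ = A' z κ := fun z hz => hA z (hXtX' hz)
    rw [lap_coverShift_eq_covLap_of_window (P.eta n) t hAX hx hstencil]
    exact h4' x b.dir (hbox hx) (hbox hxμ) fun ν => ⟨hbox (hstencil ν).1, hbox (hstencil ν).2⟩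
  · rw [hu x (hsq0X' hx)]
    exact hsid x hx

end Door

end Literature.MathematicalPhysics.QuantumFieldTheory.Balaban1983to89.Node00

end

/-! ## Axiom audit (gate whitelist: `propext`, `Classical.choice`, `Quot.sound`) -/
#print axioms Literature.MathematicalPhysics.QuantumFieldTheory.Balaban1983to89.Node00.exists_localGauge152_recTower_window_member
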